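import Mathlib.Analysis.SpecialFunctions.Log.Base
import Mathlib.Analysis.SpecialFunctions.Pow.Real
import HarnessLib

/-!
# What a ladder of certified LOWER bounds can say about a growth exponent: the H-ladder's "local exponent"

Cell `pub-fluidc` (FLUID COMPUTER; host summit `NavierStokesRegularity`, negation side, machine paradigm), prover
seat p1 (gen 6); companion to `FluidComputer.ExtremeGrowthScaling` (why `Ê = ℰ₀/ν²` is a rung coordinate of the
Kang–Yun–Protas value function) and `FluidComputer.AmplitudeLedger`. HONEST FRAMING: low prior, high
value-of-information experiment on Tao's machine paradigm; NOT a claim that NS blows up. Nothing in this file is about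
the Navier–Stokes equations: these are elementary facts about `log₂` of a ratio, typed so that the status of one number
in the atlas is unambiguous.

The number: p1's ℰ₀ = 8000 rung of the H-ladder (STATUS LEVEL line 2026-08-24, `atlas/rung-next/p1/R8K/LEVEL-E8000.md`)
reports `M_G8(8000) = 29.8668` against `M_G8(4000) = 18.6023` and the "local exponent ℰ₀ 4000 → 8000:
log₂(29.867/18.602) = 0.683" next to the pre-registered laws (compounding fit `0.661`, rung law `0.478`, KYP `0.49`).
Both level numbers are CERTIFIED LOWER BOUNDS for the level's true supremum `S(ℰ₀) = sup_T Φ_T(ℰ₀)` (each is the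
two-code 256³ forward value of an admissible field found by a 128³ ascent; two of the three ℰ₀ = 8000 ascents stopped
at the wall). This file separates what follows from what does not:

* `localExponent m₁ m₂ = log₂(m₂/m₁)` — the exponent per doubling of `ℰ₀` read off two level numbers;
  `localExponent_mono_right` / `localExponent_anti_left` — it rises with the upper number and falls with the lower one;
  `localExponent_powerLaw` — under an exact law `M(ℰ) = c ℰ^a` between `ℰ` and `2ℰ` it equals `a`.
* `le_localExponent_of_bounds` — a LOWER bound `m₂ ≤ S₂` at the upper rung together with an UPPER bound `S₁ ≤ u₁` at the
  lower rung bounds the true exponent from below: `localExponent u₁ m₂ ≤ localExponent S₁ S₂`.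
* `exists_exponent_lt` / `exists_exponent_gt` — two LOWER bounds alone (the ladder's situation: `m₁ ≤ S₁`, `m₂ ≤ S₂`)
  constrain the true exponent `localExponent S₁ S₂` NEITHER from below NOR from above. So "0.683" is the exponent of
  the certified lower-bound sequence, a statement about the optimiser's finds, not a measured exponent of `S`; it
  becomes a lower bound on the true exponent exactly when an UPPER bound at ℰ₀ = 4000 is supplied (none exists in the
  programme — the ℰ₀ = 4000 optimum is a converged local ascent, still a lower bound).
* `threshold_of_lowerBound` / `not_upper_letter_of_lowerBound` — the pre-registered letter R8-a (`M ≥ 26`) is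
  upward-closed, hence survives every one-signed caveat of the LEVEL line (each can only raise `M`); a letter of the form
  `M ≤ 21` (R8-b) could never have been concluded from lower bounds alone.
* `localExponent_R8K_bounds` — the arithmetic itself, certified: `0.68 < log₂(29.8668/18.6023) < 0.7`
  (so the lower-bound sequence grows faster per doubling than the KYP-type exponents `0.478–0.49`, and close to the
  compounding fit `0.661`; `2^{17/25}` and `2^{7/10}` compared with the exact rationals by `norm_num`).

0 sorry; axioms ⊆ {propext, Classical.choice, Quot.sound}; no named fact introduced.
-/

noncomputable section

namespace Summit.NavierStokesRegularity.FluidComputer.LadderExponent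

open Real

/-- The local growth exponent per doubling read off two level numbers `m₁` (at `ℰ`) and `m₂` (at `2ℰ`):
`localExponent m₁ m₂ = log₂ (m₂ / m₁)`. -/
def localExponent (m₁ m₂ : ℝ) : ℝ := Real.logb 2 (m₂ / m₁)

/-- Unfolding. -/
theorem localExponent_def (m₁ m₂ : ℝ) : localExponent m₁ m₂ = Real.logb 2 (m₂ / m₁) := rfl

/-- The exponent rises with the upper-rung number. -/
theorem localExponent_mono_right {m₁ m₂ m₂' : ℝ} (hm₁ : 0 < m₁) (hm₂ : 0 < m₂) (h : m₂ ≤ m₂') :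
    localExponent m₁ m₂ ≤ localExponent m₁ m₂' := by
  unfold localExponent
  exact Real.logb_le_logb_of_le (by norm_num) (div_pos hm₂ hm₁) (div_le_div_of_nonneg_right h hm₁.le)

/-- The exponent falls with the lower-rung number. -/
theorem localExponent_anti_left {m₁ m₁' m₂ : ℝ} (hm₁ : 0 < m₁) (hm₂ : 0 < m₂) (h : m₁ ≤ m₁') :
    localExponent m₁' m₂ ≤ localExponent m₁ m₂ := by
  unfold localExponent
  have hm₁' : 0 < m₁' := lt_of_lt_of_le hm₁ h
  exact Real.logb_le_logb_of_le (by norm_num) (div_pos hm₂ hm₁') (div_le_div_of_nonneg_left hm₂.le hm₁ h)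

/-- Under an exact power law `M(ℰ) = c ℰ^a` between `ℰ` and `2ℰ` the local exponent IS `a`
(so a measured local exponent tests a proposed law at that pair of rungs — when the level numbers are exact). -/
theorem localExponent_powerLaw {c E a : ℝ} (hc : 0 < c) (hE : 0 < E) :
    localExponent (c * E ^ a) (c * (2 * E) ^ a) = a := by
  unfold localExponent
  have hEa : 0 < E ^ a := Real.rpow_pos_of_pos hE a
  rw [Real.mul_rpow (by norm_num : (0:ℝ) ≤ 2) hE.le,
    show c * (2 ^ a * E ^ a) / (c * E ^ a) = 2 ^ a by field_simp]
  exact Real.logb_rpow (by norm_num) (by norm_num)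

/-- What DOES follow: a lower bound `m₂ ≤ S₂` at the upper rung and an UPPER bound `S₁ ≤ u₁` at the lower rung give a
lower bound on the true exponent, `localExponent u₁ m₂ ≤ localExponent S₁ S₂`. -/
theorem le_localExponent_of_bounds {m₂ S₂ S₁ u₁ : ℝ} (hS₁ : 0 < S₁) (hm₂ : 0 < m₂)
    (hlow : m₂ ≤ S₂) (hup : S₁ ≤ u₁) :
    localExponent u₁ m₂ ≤ localExponent S₁ S₂ :=
  (localExponent_anti_left hS₁ hm₂ hup).trans
    (localExponent_mono_right hS₁ hm₂ hlow)

/-- What does NOT follow (i): two lower bounds leave the true exponent unbounded BELOW — for every target `e` there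
are true levels `S₁ ≥ m₁`, `S₂ ≥ m₂` with `localExponent S₁ S₂ < e` (raise the lower rung). -/
theorem exists_exponent_lt {m₁ m₂ : ℝ} (hm₁ : 0 < m₁) (hm₂ : 0 < m₂) (e : ℝ) :
    ∃ S₁ S₂ : ℝ, m₁ ≤ S₁ ∧ m₂ ≤ S₂ ∧ localExponent S₁ S₂ < e := by
  -- choose S₂ = m₂ and S₁ = max m₁ (m₂ / 2^(e-1)), so that m₂ / S₁ ≤ 2^(e-1) < 2^e
  refine ⟨max m₁ (m₂ / 2 ^ (e - 1)), m₂, le_max_left _ _, le_rfl, ?_⟩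
  unfold localExponent
  have h2 : 0 < (2:ℝ) ^ (e - 1) := Real.rpow_pos_of_pos (by norm_num) _
  have hS₁ : 0 < max m₁ (m₂ / 2 ^ (e - 1)) := lt_max_of_lt_left hm₁
  rw [Real.logb_lt_iff_lt_rpow (by norm_num) (div_pos hm₂ hS₁)]
  have hle : m₂ / max m₁ (m₂ / 2 ^ (e - 1)) ≤ 2 ^ (e - 1) := by
    rw [div_le_iff₀ hS₁]
    have : m₂ / 2 ^ (e - 1) ≤ max m₁ (m₂ / 2 ^ (e - 1)) := le_max_right _ _
    calc m₂ = 2 ^ (e - 1) * (m₂ / 2 ^ (e - 1)) := by field_simp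
      _ ≤ 2 ^ (e - 1) * max m₁ (m₂ / 2 ^ (e - 1)) := mul_le_mul_of_nonneg_left this h2.le
  have hlt : (2:ℝ) ^ (e - 1) < 2 ^ e := Real.rpow_lt_rpow_of_exponent_lt (by norm_num) (by linarith)
  exact lt_of_le_of_lt hle hlt

/-- What does NOT follow (ii): two lower bounds leave the true exponent unbounded ABOVE as well — for every `e` there
are `S₁ ≥ m₁`, `S₂ ≥ m₂` with `e < localExponent S₁ S₂` (raise the upper rung). -/
theorem exists_exponent_gt {m₁ m₂ : ℝ} (hm₁ : 0 < m₁) (hm₂ : 0 < m₂) (e : ℝ) :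
    ∃ S₁ S₂ : ℝ, m₁ ≤ S₁ ∧ m₂ ≤ S₂ ∧ e < localExponent S₁ S₂ := by
  refine ⟨m₁, max m₂ (m₁ * 2 ^ (e + 1)), le_rfl, le_max_left _ _, ?_⟩
  unfold localExponent
  have h2 : 0 < (2:ℝ) ^ (e + 1) := Real.rpow_pos_of_pos (by norm_num) _
  have hS₂ : 0 < max m₂ (m₁ * 2 ^ (e + 1)) := lt_max_of_lt_left hm₂
  rw [Real.lt_logb_iff_rpow_lt (by norm_num) (div_pos hS₂ hm₁)]
  have hge : (2:ℝ) ^ (e + 1) ≤ max m₂ (m₁ * 2 ^ (e + 1)) / m₁ := by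
    rw [le_div_iff₀ hm₁]
    calc (2:ℝ) ^ (e + 1) * m₁ = m₁ * 2 ^ (e + 1) := by ring
      _ ≤ max m₂ (m₁ * 2 ^ (e + 1)) := le_max_right _ _
  have hlt : (2:ℝ) ^ e < 2 ^ (e + 1) := Real.rpow_lt_rpow_of_exponent_lt (by norm_num) (by linarith)
  exact lt_of_lt_of_le hlt hge

/-- The letter that survives lower bounds: an upward-closed threshold (`θ ≤ M`, R8-a's `26 ≤ M`) certified on a lower
bound `m ≤ S` holds for the true level: `θ ≤ m → m ≤ S → θ ≤ S`. -/
theorem threshold_of_lowerBound {θ m S : ℝ} (hθ : θ ≤ m) (hm : m ≤ S) : θ ≤ S := hθ.trans hm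

/-- … whereas a downward letter (`S ≤ κ`, R8-b's `M ≤ 21`) is NOT decided by a lower bound: whatever `m` and `κ`, some
true level `S ≥ m` violates it. -/
theorem not_upper_letter_of_lowerBound (m κ : ℝ) : ∃ S : ℝ, m ≤ S ∧ ¬ S ≤ κ :=
  ⟨max m (κ + 1), le_max_left _ _, fun h => by
    have : κ + 1 ≤ κ := (le_max_right m (κ + 1)).trans h
    linarith⟩

/-! ## The arithmetic of the ℰ₀ 4000 → 8000 step, certified -/

/-- `2^{17/25} < 29.8668 / 18.6023` (i.e. `0.68 < log₂` of the ratio): compare 25th powers of nonnegative reals. -/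
theorem two_rpow_lt_ratio : (2:ℝ) ^ ((17:ℝ) / 25) < 29.8668 / 18.6023 := by
  have h25 : ((2:ℝ) ^ ((17:ℝ) / 25)) ^ (25:ℕ) = (2:ℝ) ^ (17:ℕ) := by
    rw [← Real.rpow_natCast ((2:ℝ) ^ ((17:ℝ) / 25)) 25, ← Real.rpow_mul (by norm_num : (0:ℝ) ≤ 2),
      show (17:ℝ) / 25 * ((25:ℕ):ℝ) = ((17:ℕ):ℝ) by norm_num, Real.rpow_natCast]
  refine lt_of_pow_lt_pow_left₀ 25 (by norm_num) ?_
  rw [h25]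
  norm_num

/-- `29.8668 / 18.6023 < 2^{7/10}` (i.e. `log₂` of the ratio `< 0.7`): compare 10th powers. -/
theorem ratio_lt_two_rpow : (29.8668 : ℝ) / 18.6023 < (2:ℝ) ^ ((7:ℝ) / 10) := by
  have h10 : ((2:ℝ) ^ ((7:ℝ) / 10)) ^ (10:ℕ) = (2:ℝ) ^ (7:ℕ) := by
    rw [← Real.rpow_natCast ((2:ℝ) ^ ((7:ℝ) / 10)) 10, ← Real.rpow_mul (by norm_num : (0:ℝ) ≤ 2),
      show (7:ℝ) / 10 * ((10:ℕ):ℝ) = ((7:ℕ):ℝ) by norm_num, Real.rpow_natCast]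
  refine lt_of_pow_lt_pow_left₀ 10 (Real.rpow_nonneg (by norm_num) _) ?_
  rw [h10]
  norm_num

/-- **The ℰ₀ 4000 → 8000 local exponent of the certified lower-bound sequence lies in `(0.68, 0.7)`**:
`0.68 < localExponent 18.6023 29.8668 < 0.7` — above the KYP-type exponents `0.478 / 0.49`, near the compounding fit
`0.661`. A statement about the two certified numbers; see `exists_exponent_lt` for why it is not yet a statement about
the true level suprema. -/
theorem localExponent_R8K_bounds :
    (0.68 : ℝ) < localExponent 18.6023 29.8668 ∧ localExponent 18.6023 29.8668 < 0.7 := by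
  unfold localExponent
  have hpos : (0:ℝ) < 29.8668 / 18.6023 := by norm_num
  constructor
  · rw [show (0.68 : ℝ) = (17:ℝ) / 25 by norm_num, Real.lt_logb_iff_rpow_lt (by norm_num) hpos]
    exact two_rpow_lt_ratio
  · rw [show (0.7 : ℝ) = (7:ℝ) / 10 by norm_num, Real.logb_lt_iff_lt_rpow (by norm_num) hpos]
    exact ratio_lt_two_rpow

/-- If an UPPER bound `S(4000) ≤ 18.6023` were ever certified (it is not: the ℰ₀ = 4000 number is itself a lower bound),
the true exponent would inherit the floor: `m₂ = 29.8668 ≤ S₂`, `S₁ ≤ 18.6023` ⇒ `0.68 < localExponent S₁ S₂`. -/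
theorem true_exponent_floor_of_upper_bound {S₁ S₂ : ℝ} (hS₁ : 0 < S₁) (hup : S₁ ≤ 18.6023)
    (hlow : (29.8668 : ℝ) ≤ S₂) : (0.68 : ℝ) < localExponent S₁ S₂ :=
  lt_of_lt_of_le localExponent_R8K_bounds.1 (le_localExponent_of_bounds hS₁ (by norm_num) hlow hup)

end Summit.NavierStokesRegularity.FluidComputer.LadderExponent

end
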